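import Summits.ResolutionOfSingularities.ResolutionOfSingularities.Theorems.PurelyInseparableDim4UnitClassVertex
import HarnessLib
import HarnessLib.Audit.Tags

/-!
# Purely inseparable four-folds — the residual cone and `e_G` through a slot-unit-class re-presentation with the slot form
# demanded ONLY ON THE WEIGHT SUPPORT (cell `res-dim4-pi`, K2(p) lane, slice C; hN4-D second route; kernel hand res-dim4-p-8 g5)

[OURS · counted 0 · cell `res-dim4-pi` · K2(p) lane (holder res-dim4-p-12 g4); brick cut BY SIGNATURE by res-dim4-typ-1 g4
(bus 2026-08-29 07:44:53Z) for the D∞ `(5,4)` virtual step, taken by res-dim4-p-8 g5; proofs = res-dim4-p-7 g4's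
`…UnitClassCone` §3 / `…UnitClassVertex` §3 VERBATIM with the two-free-letter binders `i ≠ u → i ≠ f → …` replaced by
`A.r (π i) ≠ 0 → …`.]  Nothing here proves hN4-D, TAIL-D, K2(5) (`RidgeBudget.NoAboveFloorTrap 5 5`), `NoIsolatedTrap 5 5` or
resolution of singularities in dimension ≥ 4 / characteristic `p` — NOT proved.  AI kernel work, weaker than expert review.

WHY.  res-dim4-p-7 g4's slot-unit class `ℛ²` fixes two FREE letters `u, f` and asks the slot form `θ(x_{π i}) = x_i · e_i`,
`e_i(0) ≠ 0`, at the two other letters.  A `(2)`-state of the D∞ class (W₄ `four_weights_dichotomy`) has ONE boundary letter and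
THREE free letters, so those binders do not fit; but the proofs only ever use the slot form at letters CARRYING WEIGHT (to push
the boundary monomial `x^{A.r}` through the canonical jet).  This file re-types the three statements with the slot form and the
units demanded exactly on the weight support `{i : A.r (π i) ≠ 0}` — any number of slots, `d`- and `p`-generic:

* §1 **`aeval_jet_monomial_supp`** — the canonical jet `J k := Σ_l coeff_{e_l}(θ k) · x_l` on a boundary monomial `x^r`:
  `J(c · x^r) = (c · ∏_i e_i(0)^{r(π i)}) · x^{r♯}`, `r♯ = r.mapDomain π⁻¹`, as soon as `θ(x_{π i}) = x_i e_i` wherever `r (π i) ≠ 0`;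
* §2 **`resForm_of_slotUnit_rel_supp`** — `B.F = clean_p(U^p · θ A.F) + E`, `E ∈ 𝔪₀ᴹ`, `U(0) ≠ 0`, `ord₀ A.F = o`, `p ∤ o`,
  `o < M`, `J(in A.F) ≠ 0`, `x^{A.r} ∣ A.F`, `B.r = A.r♯`, slot form + units on the support ⇒ `resForm B = c · J(resForm A)`, `c ≠ 0`
  (`SwapNorm.initialForm_of_jet_rel` + §1);
* §3 **`resVertex_eq_comap_of_slotUnit_rel_supp`** — with an invertible tangent `N k i = coeff_{e_i}(θ k)` (`IsUnit N.det`,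
  e.g. `SwapTransport.isUnit_det_slotUnitClass₁/₂`) instead of `J(in A.F) ≠ 0`: `resVertex B = (resVertex A).comap (toLin' N)`
  (`additiveSubspace_C_mul` + `additiveSubspace_aeval_linSubst`; `J(in A.F) ≠ 0` from `aeval_linSubst_injective`), and
  **`finrank_resVertex_eq_of_slotUnit_rel_supp`** — `e_G(B) = e_G(A)`.

[cite: CossartJannsenSaito2020, Def. 2.8, Def. 2.18] [cite: Hauser2010, §§F–G (chart expressions; cleaning)] [folklore]
bears_on: LADDER-RESOLUTION:D157-DOOR2 (res-dim4-pi · K2(p) · slice C · hN4-D `e_G` transfer on the weight support).  Supports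
stmt-ResolutionOfSingularities-16155 (helper).
-/

set_option linter.dupNamespace false -- mandated namespace of this single-conjunct summit

noncomputable section

namespace Summit.ResolutionOfSingularities.ResolutionOfSingularities.Theorems.PIDim4

namespace SwapNorm

open MvPolynomial Finset
open Literature.AlgebraicGeometry.Resolution
open Literature.AlgebraicGeometry.Resolution.CentreBlowup
open Literature.AlgebraicGeometry.Resolution.Hauser2010
open Literature.AlgebraicGeometry.Resolution.HauserPerlega2019
open PointBlowup (polarMap additiveSubspace)

variable {K : Type} [Field K]

section SlotUnitSupp

variable (p : ℕ)
variable {π : Equiv.Perm (Fin 4)} {θ e : Fin 4 → MvPolynomial (Fin 4) K}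

/-! ## §1 The canonical jet on a boundary monomial, slot form on the support -/

/-- **The jet on a boundary monomial, slot form on its support**: if `θ(x_{π i}) = x_i e_i` at every letter with `r (π i) ≠ 0`,
then `J(c · x^r) = (c · ∏_i e_i(0)^{r(π i)}) · x^{r♯}` for the canonical jet `J k = Σ_l coeff_{e_l}(θ k) · x_l` (letters off the
support contribute `e_i(0)^0 = 1`, whatever `θ` does there). [folklore] -/
theorem aeval_jet_monomial_supp {r : Fin 4 →₀ ℕ} (hθi : ∀ i, r (π i) ≠ 0 → θ (π i) = X i * e i) (c : K) :
    aeval (fun k => ∑ l, C (coeff (Finsupp.single l 1) (θ k)) * X l) (monomial r c) =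
      C (c * ∏ i, constantCoeff (e i) ^ r (π i)) * monomial (Finsupp.mapDomain π.symm r) 1 := by
  classical
  rw [aeval_monomial, algebraMap_eq, Finsupp.prod_pow, ← Equiv.prod_comp π]
  have hfac : ∀ i, (∑ l, C (coeff (Finsupp.single l 1) (θ (π i))) * X l) ^ r (π i) =
      C (constantCoeff (e i) ^ r (π i)) * X i ^ r (π i) := by
    intro i
    by_cases hri : r (π i) = 0
    · rw [hri, pow_zero, pow_zero, pow_zero, C_1, one_mul]
    · rw [hθi i hri, linearForm_X_mul, mul_pow, ← map_pow]
  simp only [hfac]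
  rw [prod_mul_distrib, ← map_prod, map_mul, mul_assoc]
  congr 1
  rw [monomial_eq, C_1, one_mul, Finsupp.prod_pow]
  simp_rw [ResCone.mapDomain_symm_apply]

/-- The unit product over the support is non-zero. [folklore] -/
theorem prod_constantCoeff_pow_ne_zero_supp {r : Fin 4 →₀ ℕ} (he : ∀ i, r (π i) ≠ 0 → constantCoeff (e i) ≠ 0) :
    ∏ i, constantCoeff (e i) ^ r (π i) ≠ 0 := by
  refine prod_ne_zero_iff.mpr fun i _ => ?_
  by_cases hri : r (π i) = 0
  · rw [hri, pow_zero]; exact one_ne_zero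
  · exact pow_ne_zero _ (he i hri)

/-! ## §2 The residual cone through the class, slot form on the support -/

/-- **THE RESIDUAL CONE THROUGH A SLOT-UNIT-CLASS RE-PRESENTATION, SLOT FORM ON THE WEIGHT SUPPORT**: with the data of
`initialForm_of_jet_rel` for the canonical jet of `θ`, `θ(x_{π i}) = x_i e_i` with `e_i(0) ≠ 0` at every letter with
`A.r (π i) ≠ 0`, `x^{A.r} ∣ A.F` and `B.r = A.r♯`: `resForm B = c · J(resForm A)` with `c ≠ 0` (res-dim4-p-7 g4's
`resForm_of_slotUnit_rel` with its two-free-letter binders relaxed to the support). [OURS] [cite: CossartJannsenSaito2020, Def. 2.8] -/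
theorem resForm_of_slotUnit_rel_supp {A B : State K} (hθi : ∀ i, A.r (π i) ≠ 0 → θ (π i) = X i * e i)
    (he : ∀ i, A.r (π i) ≠ 0 → constantCoeff (e i) ≠ 0) (hθ0 : ∀ k, constantCoeff (θ k) = 0)
    {U E : MvPolynomial (Fin 4) K} (hU : constantCoeff U ≠ 0) {M o : ℕ} (hE : E ∈ originIdeal K ^ M)
    (hrel : B.F = deletePthPowers p (U ^ p * aeval θ A.F) + E) (ho : ordZero A.F = o) (hpo : ¬ p ∣ o) (hoM : o < M)
    (hJ0 : aeval (fun k => ∑ l, C (coeff (Finsupp.single l 1) (θ k)) * X l) (initialForm A.F) ≠ 0)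
    (hrA : ∀ d ∈ A.F.support, A.r ≤ d) (hrB : B.r = A.r.mapDomain π.symm) :
    ∃ c : K, c ≠ 0 ∧
      ResCone.resForm B = C c * aeval (fun k => ∑ l, C (coeff (Finsupp.single l 1) (θ k)) * X l) (ResCone.resForm A) := by
  classical
  set J : Fin 4 → MvPolynomial (Fin 4) K := fun k => ∑ l, C (coeff (Finsupp.single l 1) (θ k)) * X l with hJ
  have hJ1 : ∀ k, (J k).IsHomogeneous 1 := fun k => isHomogeneous_linearForm _
  have hθJ : ∀ k, θ k - J k ∈ originIdeal K ^ 2 := fun k => sub_linearForm_mem_sq (hθ0 k)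
  obtain ⟨-, hin⟩ := initialForm_of_jet_rel p hJ1 hθJ hU hE hrel ho hpo hoM hJ0
  have hE0 : ∏ i, constantCoeff (e i) ^ A.r (π i) ≠ 0 := prod_constantCoeff_pow_ne_zero_supp he
  refine ⟨constantCoeff U ^ p * ∏ i, constantCoeff (e i) ^ A.r (π i), mul_ne_zero (pow_ne_zero _ hU) hE0, ?_⟩
  set c : K := constantCoeff U ^ p * ∏ i, constantCoeff (e i) ^ A.r (π i) with hc
  unfold ResCone.resForm
  rw [hin, ← ResCone.monomial_mul_resForm hrA, map_mul, aeval_jet_monomial_supp hθi, one_mul, hrB, ← mul_assoc,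
    ← mul_assoc, ← map_mul, ← hc, show C c * (monomial (Finsupp.mapDomain (⇑(Equiv.symm π)) A.r) (1 : K)) =
      monomial (Finsupp.mapDomain (⇑(Equiv.symm π)) A.r) (1 : K) * C c by rw [mul_comm],
    mul_assoc, divMonomial_monomial_mul, divMonomial_monomial_mul]

/-! ## §3 The polar kernel and `e_G` through the class with invertible tangent, slot form on the support -/

/-- `J_N(in A.F) ≠ 0` for an invertible tangent: the initial form of a polynomial of finite order is non-zero and the linear
substitution is injective (res-dim4-p-7 g4's `aeval_linSubst_injective`). [folklore] -/
theorem aeval_jet_initialForm_ne_zero {F : MvPolynomial (Fin 4) K} {o : ℕ} (ho : ordZero F = o)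
    (hdet : IsUnit (Matrix.det (Matrix.of fun k i => coeff (Finsupp.single i 1) (θ k)))) :
    aeval (fun k => ∑ l, C (coeff (Finsupp.single l 1) (θ k)) * X l) (initialForm F) ≠ 0 := by
  classical
  set N : Matrix (Fin 4) (Fin 4) K := Matrix.of fun k i => coeff (Finsupp.single i 1) (θ k) with hN
  have hJN : (fun k => ∑ l, C (coeff (Finsupp.single l 1) (θ k)) * X l) =
      (fun k => ∑ l, C (N k l) * X l : Fin 4 → MvPolynomial (Fin 4) K) := by
    funext k; rfl
  have hin0 : initialForm F ≠ 0 := by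
    intro h0
    have h1 := Directrix.initialForm_eq_homogeneousComponent ho
    rw [h0] at h1
    obtain ⟨⟨d, hd, hdeg⟩, -⟩ := (ordZero_eq_nat_iff _ _).mp ho
    have h2 : coeff d (homogeneousComponent o F) = coeff d F := by rw [coeff_homogeneousComponent, if_pos hdeg]
    rw [← h1, coeff_zero] at h2
    exact hd h2.symm
  rw [hJN, ← map_zero (aeval (fun k => ∑ l, C (N k l) * X l) : MvPolynomial (Fin 4) K →ₐ[K] MvPolynomial (Fin 4) K)]
  exact fun h => hin0 (aeval_linSubst_injective hdet h)

/-- **THE POLAR KERNEL THROUGH THE CLASS, SLOT FORM ON THE SUPPORT**: `θ(x_{π i}) = x_i e_i` with units at the letters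
with `A.r (π i) ≠ 0`, `θ` origin-fixing, tangent `N k i = coeff_{e_i}(θ(x_k))` with `IsUnit N.det`;
`B.F = clean_p(U^p · θ A.F) + E`, `E ∈ 𝔪₀ᴹ`, `U(0) ≠ 0`, `ord₀ A.F = o`, `p ∤ o`, `o < M`, `x^{A.r} ∣ A.F`, `B.r = A.r♯` ⇒
`resVertex B = (resVertex A).comap (toLin' N)` (`v ∈ resVertex B ⟺ N *ᵥ v ∈ resVertex A`). [OURS]
[cite: CossartJannsenSaito2020, Def. 2.18] -/
theorem resVertex_eq_comap_of_slotUnit_rel_supp {A B : State K} (hθi : ∀ i, A.r (π i) ≠ 0 → θ (π i) = X i * e i)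
    (he : ∀ i, A.r (π i) ≠ 0 → constantCoeff (e i) ≠ 0) (hθ0 : ∀ k, constantCoeff (θ k) = 0)
    {U E : MvPolynomial (Fin 4) K} (hU : constantCoeff U ≠ 0) {M o : ℕ} (hE : E ∈ originIdeal K ^ M)
    (hrel : B.F = deletePthPowers p (U ^ p * aeval θ A.F) + E) (ho : ordZero A.F = o) (hpo : ¬ p ∣ o) (hoM : o < M)
    (hdet : IsUnit (Matrix.det (Matrix.of fun k i => coeff (Finsupp.single i 1) (θ k))))
    (hrA : ∀ d ∈ A.F.support, A.r ≤ d) (hrB : B.r = A.r.mapDomain π.symm) :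
    ResCone.resVertex B = (ResCone.resVertex A).comap
      (Matrix.toLin' (Matrix.of fun k i => coeff (Finsupp.single i 1) (θ k))) := by
  classical
  set N : Matrix (Fin 4) (Fin 4) K := Matrix.of fun k i => coeff (Finsupp.single i 1) (θ k) with hN
  have hJN : (fun k => ∑ l, C (coeff (Finsupp.single l 1) (θ k)) * X l) =
      (fun k => ∑ l, C (N k l) * X l : Fin 4 → MvPolynomial (Fin 4) K) := by
    funext k; rfl
  have hJ0 := aeval_jet_initialForm_ne_zero (F := A.F) ho hdet
  obtain ⟨c, hc, hres⟩ := resForm_of_slotUnit_rel_supp p hθi he hθ0 hU hE hrel ho hpo hoM hJ0 hrA hrB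
  unfold ResCone.resVertex
  rw [hres, additiveSubspace_C_mul hc, hJN, additiveSubspace_aeval_linSubst hdet]

/-- **`e_G` THROUGH THE CLASS, SLOT FORM ON THE SUPPORT**: with the data of `resVertex_eq_comap_of_slotUnit_rel_supp`,
`finrank K (resVertex B) = finrank K (resVertex A)` (res-dim4-p-7 g4's `finrank_resVertex_eq_of_slotUnit_rel` with its
two-free-letter binders relaxed to the support; serves the one-slot `(2)`-states and the two-slot `(2,1)`-states of D∞ alike).
[OURS] [cite: CossartJannsenSaito2020, Def. 2.18] -/
theorem finrank_resVertex_eq_of_slotUnit_rel_supp {A B : State K} (hθi : ∀ i, A.r (π i) ≠ 0 → θ (π i) = X i * e i)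
    (he : ∀ i, A.r (π i) ≠ 0 → constantCoeff (e i) ≠ 0) (hθ0 : ∀ k, constantCoeff (θ k) = 0)
    {U E : MvPolynomial (Fin 4) K} (hU : constantCoeff U ≠ 0) {M o : ℕ} (hE : E ∈ originIdeal K ^ M)
    (hrel : B.F = deletePthPowers p (U ^ p * aeval θ A.F) + E) (ho : ordZero A.F = o) (hpo : ¬ p ∣ o) (hoM : o < M)
    (hdet : IsUnit (Matrix.det (Matrix.of fun k i => coeff (Finsupp.single i 1) (θ k))))
    (hrA : ∀ d ∈ A.F.support, A.r ≤ d) (hrB : B.r = A.r.mapDomain π.symm) :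
    Module.finrank K (ResCone.resVertex B) = Module.finrank K (ResCone.resVertex A) := by
  classical
  set N : Matrix (Fin 4) (Fin 4) K := Matrix.of fun k i => coeff (Finsupp.single i 1) (θ k) with hN
  have hJN : (fun k => ∑ l, C (coeff (Finsupp.single l 1) (θ k)) * X l) =
      (fun k => ∑ l, C (N k l) * X l : Fin 4 → MvPolynomial (Fin 4) K) := by
    funext k; rfl
  have hJ0 := aeval_jet_initialForm_ne_zero (F := A.F) ho hdet
  obtain ⟨c, hc, hres⟩ := resForm_of_slotUnit_rel_supp p hθi he hθ0 hU hE hrel ho hpo hoM hJ0 hrA hrB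
  unfold ResCone.resVertex
  rw [hres, additiveSubspace_C_mul hc, hJN, finrank_additiveSubspace_aeval_linSubst hdet]

/-- The two-free-letter binders of res-dim4-p-7 g4 imply the support binders (so the `…_supp` theorems specialise to `ℛ²`):
if `θ(x_{π i}) = x_i e_i` for `i ∉ {u, f}` and `r (π u) = r (π f) = 0`, then the slot form holds wherever `r (π i) ≠ 0`.
[folklore] -/
theorem slotForm_supp_of_ne {u f : Fin 4} {r : Fin 4 →₀ ℕ} (hθi : ∀ i, i ≠ u → i ≠ f → θ (π i) = X i * e i)
    (hru : r (π u) = 0) (hrf : r (π f) = 0) : ∀ i, r (π i) ≠ 0 → θ (π i) = X i * e i := by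
  intro i hri
  refine hθi i (fun h => hri ?_) (fun h => hri ?_)
  · rw [h]; exact hru
  · rw [h]; exact hrf

/-- Likewise for the units. [folklore] -/
theorem units_supp_of_ne {u f : Fin 4} {r : Fin 4 →₀ ℕ} (he : ∀ i, i ≠ u → i ≠ f → constantCoeff (e i) ≠ 0)
    (hru : r (π u) = 0) (hrf : r (π f) = 0) : ∀ i, r (π i) ≠ 0 → constantCoeff (e i) ≠ 0 := by
  intro i hri
  refine he i (fun h => hri ?_) (fun h => hri ?_)
  · rw [h]; exact hru
  · rw [h]; exact hrf

end SlotUnitSupp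

end SwapNorm

end Summit.ResolutionOfSingularities.ResolutionOfSingularities.Theorems.PIDim4

end
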